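import Summits.ABC.IUTFork.Joshi.ArithmeticoidsAddenda

/-!
# [J-2½] Def. 5.2.1 / Thm. 5.5.2 (7) — topological equivalence of arithmeticoids MATCHES RESIDUE FIELDS FACTORWISE;
# Thm. 5.5.2 (7) DISCHARGED modulo print's ground made explicit (arXiv:2305.10398 §5.2, §5.5)

Block E proof-only file (cell abc-iut, rung LADDER-ABC:A2.E; seat abc-iut-E-t37, author of `ATS2h.DeformationDatum` p430482 and of
the claim-`Prop`s `DeformationDatum.TopEquivalent` / `LocalTopInequivalent` / `Thm552_7` p430871; own-claim discharge, ASSIGNMENTS §4 (1)).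
Same source and conventions: [J-2½] = K. Joshi, arXiv:2305.10398 (lit key `paper:arxiv-2305.10398`, bib `Joshi2023ATS2half`; «p.N l.M» =
line M of `HOME/plan/repair/lit/renders/Joshi-arxiv-2305.10398-ATS2half/pNNNN.txt`). TAKES NO SIDE on [IUTchIII] Cor. 3.12, on Joshi's
claims, or on Mochizuki's reports on them; typed ≠ proved for everything not derived here; nothing new is asserted (no `def`, no `Prop`).

WHAT IS DERIVED.
1. PURE ALGEBRA (`PiField.*`): a ring isomorphism `e : ∏_{i ∈ ι} A_i ≃ ∏_{j ∈ κ} B_j` of products of FIELDS sends each axis idempotent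
   `δ_i = Pi.single i 1` to an axis idempotent `δ_j` (the `δ`'s are exactly the minimal non-zero idempotents of a product of fields), and
   then `a ↦ e(δ_i a)_j` is a ring isomorphism `A_i ≃ B_j`, continuous (resp. with continuous inverse) when `e` is (product topologies).
2. [J-2½] Def. 5.2.1 (p.31 l.44–45: «topologically equivalent iff their arithmetic rings `R_y = ∏_{v ∈ V_L} K_{y_v}` are topologically
   isomorphic») READ THROUGH 1.: `TopEquivalent y₁ y₂ → ∀ v, ∃ w, K_{y₁,v} ≃ K_{y₂,w}` as topological fields
   (`TopEquivalent.exists_residueField_equiv`), and exactly: `TopEquivalent y₁ y₂ ↔ ∃ σ : V_L ≃ V_L, ∀ v, K_{y₁,v} ≃ K_{y₂,σ(v)}` as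
   topological fields (`topEquivalent_iff_perm`; ⇐ assembles the product isomorphism re-indexed by `σ`) — the isomorphism of Def. 5.2.1
   matches residue fields place by place UP TO A PERMUTATION of the places (LOCATED, for the faithfulness lane: Def. 5.2.1 as printed
   compares bare topological rings and does not ask the isomorphism to respect the index `v`).
3. [J-2½] Thm. 5.5.2 (7) (p.34 l.28 «topologically inequivalent arithmeticoids of `L` also exist»; cited by [J-III] Thm. 2.3.1 (b), seat
   T-05, through seat T-38's bridge p432383) DISCHARGED MODULO an explicit local hypothesis: if some residue field `K_{y₁,v₀}` is
   homeomorphically isomorphic to NO residue field `K_{y₂,w}` of a second arithmeticoid, then `y₁`, `y₂` are not topologically equivalent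
   (`not_topEquivalent_of_unmatched`), hence `Thm552_7` (`thm552_7_of_unmatched`). Print's proof (p.35 l.21–33: «by [Kedlaya and Temkin,
   2018], there exists, for any `v ∈ V^non_L`, a pair of closed classical points `y_{1,v}, y_{2,v}` such that the residue fields are not
   topologically isomorphic … choose `y₁, y₂ ∈ 𝒴_L` with these `v`-components; then [they] are not topologically equivalent BY
   CONSTRUCTION») supplies this hypothesis in print's setting from MORE than the typed ground `LocalTopInequivalent` ([Kedlaya–Temkin] at
   one place): it also uses, silently, that `K_{y₂,v₀}` matches no residue field at the OTHER places (`K_{y⁰,w} = L̂̄_w ≅ ℂ_{p_w}`, and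
   residue characteristics separate places over different primes) — the cross-place clause 2. shows to be necessary in the abstract
   signature, where `LocalTopInequivalent` alone does not exclude a place-permuting isomorphism. LOCATED, no verdict on print.
-/

noncomputable section

open TopologicalSpace

namespace Summit.ABC.IUTFork.Joshi.ATS2h

/-! ## 1. Ring isomorphisms of products of fields match the factors -/

namespace PiField

variable {ι κ : Type} {A : ι → Type} {B : κ → Type} [∀ i, Field (A i)] [∀ j, Field (B j)]

/-- In a product of fields, an idempotent absorbed by the axis idempotent `δ_i = Pi.single i 1` is `0` or `δ_i` (the `δ_i` are minimal
non-zero idempotents). [folklore] -/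
theorem idem_eq_zero_or_eq_single [DecidableEq ι] (i : ι) {u : ∀ i, A i} (hu : IsIdempotentElem u)
    (h : u * Pi.single i 1 = u) : u = 0 ∨ u = Pi.single i 1 := by
  have hk : ∀ k, k ≠ i → u k = 0 := fun k hk => by
    rw [← h, Pi.mul_apply, Pi.single_eq_of_ne hk, mul_zero]
  have hi : u i = 0 ∨ u i = 1 := IsIdempotentElem.iff_eq_zero_or_one.mp (congr_fun hu.eq i)
  rcases hi with hi | hi
  · left
    funext k
    by_cases hki : k = i
    · subst hki; simpa using hi
    · simpa using hk k hki
  · right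
    funext k
    by_cases hki : k = i
    · subst hki; simp [hi]
    · simp [Pi.single_eq_of_ne hki, hk k hki]

/-- A ring isomorphism of products of fields sends each axis idempotent `δ_i` to an axis idempotent `δ_j`. [folklore] -/
theorem exists_map_single_one_eq [DecidableEq ι] [DecidableEq κ] (e : (∀ i, A i) ≃+* (∀ j, B j)) (i : ι) :
    ∃ j, e (Pi.single i 1) = Pi.single j 1 := by
  set ε := e (Pi.single i 1) with hε
  -- `ε` is a non-zero idempotent
  have hεε : ε * ε = ε := by rw [hε, ← map_mul, ← Pi.single_mul, mul_one]
  have hε0 : ε ≠ 0 := by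
    rw [hε, map_ne_zero_iff e e.injective]
    intro h0
    have := congr_fun h0 i
    simp at this
  obtain ⟨j, hj⟩ := Function.ne_iff.mp hε0
  -- its `j`-th coordinate is an idempotent of the field `B j`, non-zero, hence `1`
  have hj1 : ε j = 1 := (IsIdempotentElem.iff_eq_zero_or_one.mp (congr_fun hεε j)).resolve_left hj
  refine ⟨j, ?_⟩
  -- pull `δ_j` back: it is an idempotent absorbed by `δ_i`, non-zero, hence `δ_i`
  have habs : Pi.single j (1 : B j) * ε = Pi.single j 1 := by
    funext k
    by_cases hkj : k = j
    · subst hkj; simp [hj1]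
    · simp [Pi.single_eq_of_ne hkj]
  have hu : IsIdempotentElem (e.symm (Pi.single j 1)) := by
    change e.symm (Pi.single j 1) * e.symm (Pi.single j 1) = e.symm (Pi.single j 1)
    rw [← map_mul, ← Pi.single_mul, mul_one]
  have hu' : e.symm (Pi.single j 1) * Pi.single i 1 = e.symm (Pi.single j 1) := by
    have : Pi.single i (1 : A i) = e.symm ε := by rw [hε, RingEquiv.symm_apply_apply]
    rw [this, ← map_mul, habs]
  rcases idem_eq_zero_or_eq_single i hu hu' with h0 | h1
  · exfalso
    have : (Pi.single j (1 : B j)) j = 0 := by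
      have h0' : Pi.single j (1 : B j) = 0 := by simpa using congr_arg e h0
      rw [h0']; rfl
    simp at this
  · have := congr_arg e h1
    rw [RingEquiv.apply_symm_apply] at this
    exact hε.trans this.symm

/-- If `e(δ_i) = δ_j`, then `e` maps the `i`-th axis into the `j`-th axis: all other coordinates of `e(δ_i a)` vanish. [folklore] -/
theorem apply_single_apply_of_ne [DecidableEq ι] [DecidableEq κ] (e : (∀ i, A i) ≃+* (∀ j, B j)) {i : ι} {j : κ}
    (h : e (Pi.single i 1) = Pi.single j 1) (a : A i) {k : κ} (hk : k ≠ j) : e (Pi.single i a) k = 0 := by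
  have hmul : e (Pi.single i a) = e (Pi.single i a) * Pi.single j 1 := by
    rw [← h, ← map_mul, ← Pi.single_mul, mul_one]
  rw [hmul, Pi.mul_apply, Pi.single_eq_of_ne hk, mul_zero]

/-- If `e(δ_i) = δ_j`, then `e(δ_i a) = δ_j (e(δ_i a)_j)`. [folklore] -/
theorem apply_single_eq [DecidableEq ι] [DecidableEq κ] (e : (∀ i, A i) ≃+* (∀ j, B j)) {i : ι} {j : κ}
    (h : e (Pi.single i 1) = Pi.single j 1) (a : A i) : e (Pi.single i a) = Pi.single j (e (Pi.single i a) j) := by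
  funext k
  by_cases hk : k = j
  · subst hk; simp
  · rw [Pi.single_eq_of_ne hk, apply_single_apply_of_ne e h a hk]

/-- **Factor matching.** A ring isomorphism `e : ∏_i A_i ≃ ∏_j B_j` of products of fields with `e(δ_i) = δ_j` induces the ring
isomorphism `a ↦ e(δ_i a)_j : A_i ≃ B_j` (inverse `b ↦ e⁻¹(δ_j b)_i`); it is continuous if `e` is, and its inverse is continuous if
`e⁻¹` is (product topologies on both sides). [folklore] -/
theorem exists_ringEquiv_of_map_single [DecidableEq ι] [DecidableEq κ] [∀ i, TopologicalSpace (A i)]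
    [∀ j, TopologicalSpace (B j)] (e : (∀ i, A i) ≃+* (∀ j, B j)) {i : ι} {j : κ}
    (h : e (Pi.single i 1) = Pi.single j 1) :
    ∃ f : A i ≃+* B j, (∀ a, f a = e (Pi.single i a) j) ∧ (Continuous e → Continuous f) ∧
      (Continuous e.symm → Continuous f.symm) := by
  have h' : e.symm (Pi.single j 1) = Pi.single i 1 := by rw [← h, RingEquiv.symm_apply_apply]
  let f : A i ≃+* B j :=
    { toFun := fun a => e (Pi.single i a) j
      invFun := fun b => e.symm (Pi.single j b) i
      left_inv := fun a => by
        change e.symm (Pi.single j (e (Pi.single i a) j)) i = a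
        rw [← apply_single_eq e h a, RingEquiv.symm_apply_apply, Pi.single_eq_same]
      right_inv := fun b => by
        change e (Pi.single i (e.symm (Pi.single j b) i)) j = b
        rw [← apply_single_eq e.symm h' b, RingEquiv.apply_symm_apply, Pi.single_eq_same]
      map_mul' := fun a a' => by rw [Pi.single_mul, map_mul, Pi.mul_apply]
      map_add' := fun a a' => by rw [Pi.single_add, map_add, Pi.add_apply] }
  refine ⟨f, fun a => rfl, fun he => ?_, fun he' => ?_⟩
  · exact (continuous_apply j).comp (he.comp (continuous_single i))
  · change Continuous fun b => e.symm (Pi.single j b) i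
    exact (continuous_apply i).comp (he'.comp (continuous_single j))

/-- **Every factor of the source is matched with a factor of the target**: a ring isomorphism of products of fields that is a
homeomorphism for the product topologies restricts, for each `i`, to an isomorphism of topological fields `A_i ≃ B_j` for some `j`.
[folklore] -/
theorem exists_factor_equiv [∀ i, TopologicalSpace (A i)] [∀ j, TopologicalSpace (B j)] (e : (∀ i, A i) ≃+* (∀ j, B j))
    (he : Continuous e) (he' : Continuous e.symm) (i : ι) :
    ∃ j, ∃ f : A i ≃+* B j, Continuous f ∧ Continuous f.symm := by
  classical
  obtain ⟨j, hj⟩ := exists_map_single_one_eq e i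
  obtain ⟨f, -, hf, hf'⟩ := exists_ringEquiv_of_map_single e hj
  exact ⟨j, f, hf he, hf' he'⟩

/-- **The matching is a bijection of the index sets**: a ring isomorphism of products of fields `∏_i A_i ≃ ∏_j B_j` permutes the axis
idempotents along a bijection `σ : ι ≃ κ`, `e(δ_i) = δ_{σ i}` (injective since `e` is; surjective by the same fact for `e⁻¹`). [folklore] -/
theorem exists_index_equiv [DecidableEq ι] [DecidableEq κ] (e : (∀ i, A i) ≃+* (∀ j, B j)) :
    ∃ σ : ι ≃ κ, ∀ i, e (Pi.single i 1) = Pi.single (σ i) 1 := by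
  choose σ hσ using exists_map_single_one_eq e
  have hinj : Function.Injective σ := fun i i' h => by
    have hs : (Pi.single i (1 : A i) : ∀ i, A i) = Pi.single i' 1 := e.injective (by rw [hσ i, hσ i', h])
    by_contra hne
    have := congr_fun hs i
    rw [Pi.single_eq_same, Pi.single_eq_of_ne hne] at this
    exact one_ne_zero this
  have hsurj : Function.Surjective σ := fun j => by
    obtain ⟨i, hi⟩ := exists_map_single_one_eq e.symm j
    refine ⟨i, ?_⟩
    have h1 : e (Pi.single i 1) = Pi.single j 1 := by rw [← hi, RingEquiv.apply_symm_apply]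
    have hs : (Pi.single j (1 : B j) : ∀ j, B j) = Pi.single (σ i) 1 := h1.symm.trans (hσ i)
    by_contra hne
    have := congr_fun hs j
    rw [Pi.single_eq_same, Pi.single_eq_of_ne (Ne.symm hne)] at this
    exact one_ne_zero this
  exact ⟨Equiv.ofBijective σ ⟨hinj, hsurj⟩, fun i => hσ i⟩

/-- Hence a ring isomorphism of products of fields, bicontinuous for the product topologies, is «factorwise up to re-indexing»: along a
bijection `σ : ι ≃ κ` every factor `A_i` is isomorphic to `B_{σ i}` as a topological field. [folklore] -/
theorem exists_index_equiv_factor_equiv [∀ i, TopologicalSpace (A i)] [∀ j, TopologicalSpace (B j)]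
    (e : (∀ i, A i) ≃+* (∀ j, B j)) (he : Continuous e) (he' : Continuous e.symm) :
    ∃ σ : ι ≃ κ, ∀ i, ∃ f : A i ≃+* B (σ i), Continuous f ∧ Continuous f.symm := by
  classical
  obtain ⟨σ, hσ⟩ := exists_index_equiv e
  refine ⟨σ, fun i => ?_⟩
  obtain ⟨f, -, hf, hf'⟩ := exists_ringEquiv_of_map_single e (hσ i)
  exact ⟨f, hf he, hf' he'⟩

end PiField

/-! ## 2.–3. Def. 5.2.1 read factorwise; Thm. 5.5.2 (7) modulo an unmatched residue field -/

namespace DeformationDatum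

variable {L : Type} [Field L] {V : Type} {Lv : V → Type} [∀ v, Field (Lv v)] {Y : V → Type}
  [∀ v, TopologicalSpace (Y v)] {K : (v : V) → Y v → Type} [∀ v y, Field (K v y)] [∀ v y, TopologicalSpace (K v y)]
  {G : V → Type} [∀ v, Group (G v)] {A : V → Type} [∀ v, Group (A v)]
  (D : DeformationDatum L V Lv Y K G A)

/-- **[J-2½] Def. 5.2.1 read factorwise** (p.31 l.44–45): if `arith(L)_{y₁}` and `arith(L)_{y₂}` are topologically equivalent — their
arithmetic rings `∏_v K_{y₁,v}`, `∏_w K_{y₂,w}` are isomorphic as topological rings — then every residue field `K_{y₁,v}` is isomorphic,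
as a topological field, to SOME residue field `K_{y₂,w}` (the place `w` need not be `v`: Def. 5.2.1 does not index the isomorphism by
the places). [claim: Joshi2023ATS2half, status: disputed] -/
theorem TopEquivalent.exists_residueField_equiv {y₁ y₂ : D.Arith} (h : D.TopEquivalent y₁ y₂) (v : V) :
    ∃ w, ∃ f : K v (y₁ v) ≃+* K w (y₂ w), Continuous f ∧ Continuous f.symm := by
  obtain ⟨e, he, he'⟩ := h
  exact PiField.exists_factor_equiv (A := fun v => K v (y₁ v)) (B := fun w => K w (y₂ w)) e he he' v

/-- **[J-2½] Def. 5.2.1 = «residue fields homeomorphically isomorphic along a PERMUTATION of the places»** (⇒): a topological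
equivalence `arith(L)_{y₁} ~ arith(L)_{y₂}` provides a bijection `σ : V_L ≃ V_L` and isomorphisms of topological fields
`K_{y₁,v} ≃ K_{y₂,σ(v)}` for every `v`. [claim: Joshi2023ATS2half, status: disputed] -/
theorem TopEquivalent.exists_perm {y₁ y₂ : D.Arith} (h : D.TopEquivalent y₁ y₂) :
    ∃ σ : V ≃ V, ∀ v, ∃ f : K v (y₁ v) ≃+* K (σ v) (y₂ (σ v)), Continuous f ∧ Continuous f.symm := by
  obtain ⟨e, he, he'⟩ := h
  exact PiField.exists_index_equiv_factor_equiv (A := fun v => K v (y₁ v)) (B := fun w => K w (y₂ w)) e he he'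

/-- (⇐): conversely, isomorphisms of topological fields `K_{y₁,v} ≃ K_{y₂,σ(v)}` along any bijection `σ` of the places assemble (product,
then re-indexing by `σ`) into an isomorphism of topological rings `R_{y₁} ≃ R_{y₂}`, i.e. a topological equivalence in the sense of
Def. 5.2.1 — also when `σ ≠ 1`. [claim: Joshi2023ATS2half, status: disputed] -/
theorem topEquivalent_of_perm {y₁ y₂ : D.Arith} (σ : V ≃ V)
    (h : ∀ v, ∃ f : K v (y₁ v) ≃+* K (σ v) (y₂ (σ v)), Continuous f ∧ Continuous f.symm) : D.TopEquivalent y₁ y₂ := by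
  choose f hf hf' using h
  let F : (∀ v, K v (y₁ v)) ≃+* (∀ v, K (σ v) (y₂ (σ v))) := RingEquiv.piCongrRight f
  let E : (∀ v, K (σ v) (y₂ (σ v))) ≃+* (∀ w, K w (y₂ w)) := RingEquiv.piCongrLeft (fun w => K w (y₂ w)) σ
  have hF : Continuous F := continuous_pi fun v => (hf v).comp (continuous_apply v)
  have hF' : Continuous F.symm := continuous_pi fun v => (hf' v).comp (continuous_apply v)
  have hE : Continuous E := (Homeomorph.piCongrLeft (Y := fun w => K w (y₂ w)) σ).continuous
  have hE' : Continuous E.symm := (Homeomorph.piCongrLeft (Y := fun w => K w (y₂ w)) σ).symm.continuous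
  exact ⟨F.trans E, hE.comp hF, hF'.comp hE'⟩

/-- **[J-2½] Def. 5.2.1, LOCATED READING**: `arith(L)_{y₁}` and `arith(L)_{y₂}` are topologically equivalent iff their residue fields
are isomorphic as topological fields along SOME permutation `σ` of `V_L` (not necessarily the identity: the printed definition compares
the arithmetic rings as bare topological rings). [claim: Joshi2023ATS2half, status: disputed] -/
theorem topEquivalent_iff_perm {y₁ y₂ : D.Arith} :
    D.TopEquivalent y₁ y₂ ↔ ∃ σ : V ≃ V, ∀ v, ∃ f : K v (y₁ v) ≃+* K (σ v) (y₂ (σ v)), Continuous f ∧ Continuous f.symm :=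
  ⟨fun h => TopEquivalent.exists_perm D h, fun ⟨σ, h⟩ => topEquivalent_of_perm D σ h⟩

/-- **An unmatched residue field separates arithmeticoids topologically**: if `K_{y₁,v₀}` is isomorphic as a topological field to no
`K_{y₂,w}` (`w ∈ V_L` arbitrary, `w = v₀` included), then `arith(L)_{y₁}` and `arith(L)_{y₂}` are not topologically equivalent (Def.
5.2.1). This is the step print's proof of Thm. 5.5.2 (7) calls «by construction» (p.35 l.30–33), with its cross-place clause explicit.
[claim: Joshi2023ATS2half, status: disputed] -/
theorem not_topEquivalent_of_unmatched {y₁ y₂ : D.Arith} (v₀ : V)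
    (h : ∀ w, ¬ ∃ f : K v₀ (y₁ v₀) ≃+* K w (y₂ w), Continuous f ∧ Continuous f.symm) : ¬ D.TopEquivalent y₁ y₂ :=
  fun hT => by
    obtain ⟨w, f, hf, hf'⟩ := TopEquivalent.exists_residueField_equiv D hT v₀
    exact h w ⟨f, hf, hf'⟩

/-- The same with the roles of `y₁`, `y₂` exchanged (topological equivalence is symmetric, `TopEquivalent.symm` p433085). [claim:
Joshi2023ATS2half, status: disputed] -/
theorem not_topEquivalent_of_unmatched' {y₁ y₂ : D.Arith} (v₀ : V)
    (h : ∀ w, ¬ ∃ f : K v₀ (y₂ v₀) ≃+* K w (y₁ w), Continuous f ∧ Continuous f.symm) : ¬ D.TopEquivalent y₁ y₂ :=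
  fun hT => not_topEquivalent_of_unmatched D v₀ h (TopEquivalent.symm D hT)

/-- **[J-2½] Thm. 5.5.2 (7) DISCHARGED modulo print's ground made explicit** (p.34 l.28; proof p.35 l.21–33): if there are arithmeticoids
`y₁, y₂` and a place `v₀` such that the residue field `K_{y₁,v₀}` is isomorphic as a topological field to no residue field of `y₂`, then
«topologically inequivalent arithmeticoids of `L` exist» (`Thm552_7`, p430871). In print the data are `y₂ = y⁰` (every
`K_{y⁰,w} = L̂̄_w`, proof of (6) p.35 l.1–18) and `y₁ = y⁰` changed at one `v₀ ∈ V^non_L` into a [Kedlaya–Temkin 2018] untilt whose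
residue field is not homeomorphic to `L̂̄_{v₀}` (`LocalTopInequivalent`) nor — the clause print leaves implicit — to any `L̂̄_w`, `w ≠ v₀`.
[claim: Joshi2023ATS2half, status: disputed] -/
theorem thm552_7_of_unmatched
    (h : ∃ (y₁ y₂ : D.Arith) (v₀ : V), ∀ w, ¬ ∃ f : K v₀ (y₁ v₀) ≃+* K w (y₂ w), Continuous f ∧ Continuous f.symm) :
    D.Thm552_7 := by
  obtain ⟨y₁, y₂, v₀, h⟩ := h
  exact ⟨y₁, y₂, not_topEquivalent_of_unmatched D v₀ h⟩

end DeformationDatum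

end Summit.ABC.IUTFork.Joshi.ATS2h
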